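import Literature.ModelTheory.FiniteModelTheory.ESOPrefixClasses
import Mathlib.GroupTheory.Perm.Cycle.Type
import HarnessLib

/-!
# Calibration of the prefix class `ESO(∃*∀∃∀)` over graphs: `EVEN` is definable

Topic `Literature/ModelTheory/FiniteModelTheory`; companion of `ESOPrefixClasses.lean` (route
PneNP/NonThreeColCutRectangles, crux `NonThreeColNotAEA` = "non-3-colourability is NOT
`ESO(∃*∀∃∀)`-definable"). This file is the POSITIVE calibration of that typing: the class `EVEN` of
binary tables on a universe of even size — the textbook example of a property of finite structures
that is not first-order definable (Libkin 2004, Cor. 3.19 / Prop. 3.6 via EF games) — IS definable in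
`ESO(∃*∀∃∀)`, indeed with one binary witness relation, no leading first-order existentials and the
matrix

  `θ(x,y,z) := S(x,y) ∧ x ≠ y ∧ (S(x,z) → z = y) ∧ (S(x,z) → S(z,x))`,

since `∃S ∀x ∃y ∀z θ` says exactly that `S` is the graph of a fixed-point-free involution, which
exists iff the universe is even (Libkin 2004, §9.1: EVEN ∈ ∃SO via "a binary relation that is an
equivalence with classes of size two" — here trimmed to the prefix `∀∃∀`). So `IsPrefixDefinable [2]
[∀,∃,∀]` is a non-vacuous notion separating a non-first-order class from the empty/universal ones,
which is what the negative crux needs of its typing.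

* `evenClass` — `{⟨n, R⟩ | n even}` as a class of `[2]`-structures;
* `EvenAEA.theta`, `EvenAEA.isQF_theta`, `EvenAEA.realize_theta` — the matrix and its semantics;
* `isPrefixDefinable_forallExistsForall_evenClass` — **`EVEN ∈ ESO(∃*∀∃∀)`** (proved).

## References

* L. Libkin, *Elements of Finite Model Theory*, Springer 2004, §3 (EVEN is not FO), §9.1 (EVEN in
  ∃SO with one binary relation). Held copy `book:libkinnd-elements-finite-model-theory`.
* G. Gottlob, P. Kolaitis, T. Schwentick, *Existential second-order logic over graphs: charting the
  tractability frontier*, J. ACM 51 (2004), §1 (the classes `ESO(∃* w)`).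
-/

namespace Literature.ModelTheory.FiniteModelTheory

open Literature.Computability.Cryptography FirstOrder FirstOrder.Language

/-- The class `EVEN` of binary tables on a universe `Fin n` with `n` even. [Libkin 2004, §3
(the query EVEN)] [cite: Libkin2004, §3] -/
def evenClass : Set (SNPInstance [2]) :=
  {x | Even x.1}

/-- Membership in `evenClass`. [folklore] -/
@[simp] theorem mem_evenClass_iff (x : SNPInstance [2]) : x ∈ evenClass ↔ Even x.1 := Iff.rfl

namespace EvenAEA

/-- The joint vocabulary: one binary input `E`, one binary witness `S`. [folklore] -/
abbrev L : FirstOrder.Language := JointLang [2] [2]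

/-- The witness symbol `S`. [folklore] -/
def symS : L.Relations 2 := Sum.inr ⟨⟨0, by decide⟩, rfl⟩

/-- The atom `S(x_i, x_j)` on the three bound variables. [folklore] -/
def atomS (i j : Fin 3) : L.BoundedFormula Empty 3 :=
  Relations.boundedFormula symS ![Term.var (Sum.inr i), Term.var (Sum.inr j)]

/-- The atom `x_i = x_j`. [folklore] -/
def eqv (i j : Fin 3) : L.BoundedFormula Empty 3 :=
  Term.bdEqual (Term.var (Sum.inr i)) (Term.var (Sum.inr j))

/-- The matrix `θ(x,y,z) := S(x,y) ∧ ¬ x = y ∧ (S(x,z) → z = y) ∧ (S(x,z) → S(z,x))`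
(variables `0 = x`, `1 = y`, `2 = z`). [Libkin 2004, §9.1 (EVEN ∈ ∃SO)] [cite: Libkin2004, §9.1] -/
def theta : L.BoundedFormula Empty 3 :=
  ((atomS 0 1 ⊓ (eqv 0 1).not) ⊓ ((atomS 0 2).imp (eqv 2 1))) ⊓ ((atomS 0 2).imp (atomS 2 0))

/-- `θ` is quantifier-free. [folklore] -/
theorem isQF_theta : theta.IsQF :=
  (((BoundedFormula.IsAtomic.rel _ _).isQF.inf (BoundedFormula.IsAtomic.equal _ _).isQF.not).inf
    ((BoundedFormula.IsAtomic.rel _ _).isQF.imp (BoundedFormula.IsAtomic.equal _ _).isQF)).inf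
    ((BoundedFormula.IsAtomic.rel _ _).isQF.imp (BoundedFormula.IsAtomic.rel _ _).isQF)

/-- The Boolean value of the witness table on the pair `(a, b)`. [folklore] -/
def sVal {n : ℕ} (W : RelTables [2] n) (a b : Fin n) : Bool :=
  W ⟨0, by decide⟩ ![a, b]

/-- Semantics of the atom `S(x_i,x_j)` in the joint structure. [folklore] -/
theorem realize_atomS {n : ℕ} (R W : RelTables [2] n) (xs : Fin 3 → Fin n) (i j : Fin 3) :
    @BoundedFormula.Realize L (Fin n) (jointStructure R W) _ _ (atomS i j) default xs ↔
      sVal W (xs i) (xs j) = true := by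
  letI := jointStructure R W
  unfold atomS
  rw [BoundedFormula.realize_rel]
  show W ⟨0, by decide⟩ _ = true ↔ _
  unfold sVal
  constructor <;> intro h <;> convert h using 2 <;> funext k <;> fin_cases k <;> rfl

/-- Semantics of the atom `x_i = x_j`. [folklore] -/
theorem realize_eqv {n : ℕ} (R W : RelTables [2] n) (xs : Fin 3 → Fin n) (i j : Fin 3) :
    @BoundedFormula.Realize L (Fin n) (jointStructure R W) _ _ (eqv i j) default xs ↔
      xs i = xs j := by
  letI := jointStructure R W
  unfold eqv
  rw [BoundedFormula.realize_bdEqual]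
  rfl

/-- Semantics of the matrix. [folklore] -/
theorem realize_theta {n : ℕ} (R W : RelTables [2] n) (xs : Fin 3 → Fin n) :
    @BoundedFormula.Realize L (Fin n) (jointStructure R W) _ _ theta default xs ↔
      (sVal W (xs 0) (xs 1) = true ∧ xs 0 ≠ xs 1) ∧
        (sVal W (xs 0) (xs 2) = true → xs 2 = xs 1) ∧
        (sVal W (xs 0) (xs 2) = true → sVal W (xs 2) (xs 0) = true) := by
  letI := jointStructure R W
  simp only [theta, BoundedFormula.realize_inf, BoundedFormula.realize_imp,
    BoundedFormula.realize_not, realize_atomS, realize_eqv]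
  tauto

/-- Three successive `Fin.snoc`s onto the empty tuple give the literal triple. [folklore] -/
theorem snoc_snoc_snoc {M : Type*} (cs : Fin 0 → M) (a b c : M) :
    (Fin.snoc (Fin.snoc (Fin.snoc cs a : Fin 1 → M) b : Fin 2 → M) c : Fin 3 → M) = ![a, b, c] := by
  funext i
  fin_cases i <;> rfl

/-- Semantics of the whole first-order part `∀x ∃y ∀z θ`. [folklore] -/
theorem realize_prefix_theta {n : ℕ} (R W : RelTables [2] n) (cs : Fin 0 → Fin n) :
    @BoundedFormula.Realize L (Fin n) (jointStructure R W) _ _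
        (FOQuant.closePrefix [FOQuant.all, FOQuant.ex, FOQuant.all] theta) default cs ↔
      ∀ a : Fin n, ∃ b : Fin n, ∀ c : Fin n,
        (sVal W a b = true ∧ a ≠ b) ∧ (sVal W a c = true → c = b) ∧
          (sVal W a c = true → sVal W c a = true) := by
  letI := jointStructure R W
  simp only [FOQuant.closePrefix_cons, FOQuant.closePrefix_nil, FOQuant.realize_close_all,
    FOQuant.realize_close_ex]
  refine forall_congr' fun a => exists_congr fun b => forall_congr' fun c => ?_
  rw [snoc_snoc_snoc, realize_theta]
  simp

/-! ### The combinatorics: fixed-point-free involutions exist exactly on even universes -/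

/-- A fixed-point-free involution of `Fin n` forces `n` to be even. [folklore] -/
theorem even_of_involutive_fixedPointFree {n : ℕ} (f : Fin n → Fin n)
    (hf : Function.Involutive f) (hfix : ∀ x, f x ≠ x) : Even n := by
  classical
  set σ : Equiv.Perm (Fin n) := hf.toPerm f
  have hσ : σ ^ 2 = 1 := by
    ext x
    simp [σ, sq, Equiv.Perm.mul_apply, hf x]
  have hsupp : σ.support = Finset.univ := by
    ext x
    simp [Equiv.Perm.mem_support, σ, hfix x]
  have h2 := Equiv.Perm.two_dvd_card_support hσ
  rw [hsupp, Finset.card_univ, Fintype.card_fin] at h2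
  exact even_iff_two_dvd.mpr h2

/-- On an even universe, `x ↦ x xor 1` (swap `2i ↔ 2i+1`) is a fixed-point-free involution.
[folklore] -/
def swapPair {n : ℕ} (hn : Even n) (x : Fin n) : Fin n :=
  ⟨if x.val % 2 = 0 then x.val + 1 else x.val - 1, by
    obtain ⟨k, hk⟩ := hn
    have hx := x.isLt
    split_ifs with h <;> omega⟩

/-- Value of `swapPair`. [folklore] -/
theorem swapPair_val {n : ℕ} (hn : Even n) (x : Fin n) :
    (swapPair hn x).val = if x.val % 2 = 0 then x.val + 1 else x.val - 1 := rfl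

/-- `swapPair` has no fixed point. [folklore] -/
theorem swapPair_ne {n : ℕ} (hn : Even n) (x : Fin n) : swapPair hn x ≠ x := by
  intro h
  have := congrArg Fin.val h
  rw [swapPair_val] at this
  split_ifs at this with h0 <;> omega

/-- `swapPair` is an involution. [folklore] -/
theorem swapPair_swapPair {n : ℕ} (hn : Even n) (x : Fin n) : swapPair hn (swapPair hn x) = x := by
  apply Fin.ext
  rw [swapPair_val, swapPair_val]
  have hx := x.isLt
  obtain ⟨k, hk⟩ := hn
  split_ifs with h1 h2 h2 <;> omega

/-! ### `EVEN ∈ ESO(∃*∀∃∀)` -/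

/-- The model class of `∃S ∀x∃y∀z θ` is `EVEN`. [Libkin 2004, §9.1] [cite: Libkin2004, §9.1] -/
theorem mem_modelClass_theta_iff (x : SNPInstance [2]) :
    x ∈ (ESOSentence.ofPrefix [2] (p := 0) [FOQuant.all, FOQuant.ex, FOQuant.all] theta).modelClass ↔
      Even x.1 := by
  obtain ⟨n, R⟩ := x
  rw [ESOSentence.mem_modelClass_ofPrefix_iff]
  constructor
  · rintro ⟨W, cs, h⟩
    rw [realize_prefix_theta] at h
    choose f hf using h
    refine even_of_involutive_fixedPointFree f ?_ ?_
    · intro a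
      have h1 : sVal W a (f a) = true := (hf a (f a)).1.1
      have h2 : sVal W (f a) a = true := (hf a (f a)).2.2 h1
      exact ((hf (f a) a).2.1 h2).symm
    · intro a
      exact fun h => (hf a (f a)).1.2 h.symm
  · intro hn
    refine ⟨fun _ v => decide (v ⟨1, by simp⟩ = swapPair hn (v ⟨0, by simp⟩)), Fin.elim0, ?_⟩
    rw [realize_prefix_theta]
    intro a
    refine ⟨swapPair hn a, fun c => ⟨⟨?_, (swapPair_ne hn a).symm⟩, ?_, ?_⟩⟩
    · simp [sVal]
    · intro h
      simpa [sVal] using h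
    · intro h
      have hc : c = swapPair hn a := by simpa [sVal] using h
      subst hc
      simp [sVal, swapPair_swapPair]

end EvenAEA

/-- **`EVEN ∈ ESO(∃*∀∃∀)` over graphs**: the class of binary tables on an even universe is
definable by an existential second-order sentence with one binary witness relation and first-order
prefix `∀∃∀` over a quantifier-free matrix. Positive calibration of `IsPrefixDefinable [2]
[∀,∃,∀]` (a non-first-order class inside the prefix class that the crux `NonThreeColNotAEA` claims
excludes non-3-colourability). [Libkin 2004, §9.1 (EVEN ∈ ∃SO); Gottlob–Kolaitis–Schwentick 2004, §1]
[cite: Libkin2004, §9.1] -/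
theorem isPrefixDefinable_forallExistsForall_evenClass :
    IsPrefixDefinable [2] [FOQuant.all, FOQuant.ex, FOQuant.all] evenClass :=
  ⟨[2], 0, EvenAEA.theta, EvenAEA.isQF_theta, Set.ext EvenAEA.mem_modelClass_theta_iff⟩

end Literature.ModelTheory.FiniteModelTheory
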